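import Mathlib
import Summits.Ventures.PercRepro2.Defs
import Summits.Ventures.PercRepro2.Graph
import Summits.Ventures.PercRepro2.OneColourSwitch
import Summits.Ventures.PercRepro2.M9PendantMirror
import Summits.Ventures.PercRepro2.M9LoopTransfer
import Summits.Ventures.PercRepro2.M9PendantSeries
import Summits.Ventures.PercRepro2.M9ReducibleClass
import Summits.Ventures.PercRepro2.M9ParallelContract
import Summits.Ventures.PercRepro2.M9ReducibleSP
import Summits.Ventures.PercRepro2.M9NoPocketDefs
import Summits.Ventures.PercRepro2.M9NoPocketM9
import Summits.Ventures.PercRepro2.M9ReducibleNP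
import Summits.Ventures.PercRepro2.M9NoPocketSetDefs
import Summits.Ventures.PercRepro2.M9NoPocketSetM9

/-!
# The series–parallel reducible class with the no-pocket multi-`d` base (blind cell
PercRepro2, p3 g20, 2026-08-27; `proofs/P3-CPNC.md` §17i (2), §17j)

`ReducibleNPSS p q r s ends` is `ReducibleNPS` (`M9ReducibleNPS`: the `DZero`, cut-vertex and
single-`d` bases, the pair swap, the pendant, series and parallel reductions) with ONE MORE
BASE: the no-pocket multi-`d` class of `M9NoPocketSetM9` — a set `D` of pairwise non-adjacent
non-marks such that every non-mark outside `D` is adjacent to `p` or `q` and every neighbour of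
a vertex of `D` other than `r, s` is adjacent to `r` or `s`.  `m9SignSum_nonpos_of_reducibleNPSS`
proves `Σ_{Sep} σ_pq · σ_rs ≤ 0` on the whole class.  Own work, one seat.
-/

namespace Summit.Ventures.PercRepro2

namespace M9Reduce

open OneColourSwitch Classical Finset SideSwitch

variable {V : Type*} {E : Type*}

section ReducibleNPS

variable [Fintype V] [DecidableEq V] [Fintype E] [DecidableEq E]

/-- The series–parallel reducible class with the no-pocket single-`d` base. -/
inductive ReducibleNPS : V → V → V → V → (E → Sym2 V) → Prop
  /-- every `ReducibleNP` graph -/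
  | ofReducibleNP {p q r s : V} {ends : E → Sym2 V} (h : ReducibleNP p q r s ends) :
      ReducibleNPS p q r s ends
  /-- the no-pocket multi-`d` class: `D` pairwise non-adjacent, every non-mark outside `D`
  adjacent to `p` or `q`, every neighbour of a vertex of `D` other than `r, s` adjacent to `r` or
  `s` -/
  | noPocketSet {p q r s : V} {D : Finset V} {ends : E → Sym2 V}
      (hnp : NoPocketSet.NoPocketAt ends D r s) (hind : NoPocketSet.DIndep ends D)
      (hadj : ∀ x, Nonmark p q r s x → x ∉ D → ∃ e, ends e = s(x, p) ∨ ends e = s(x, q))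
      (hpD : p ∉ D) (hqD : q ∉ D) (hDr : ∀ d ∈ D, d ≠ r) (hDs : ∀ d ∈ D, d ≠ s) :
      ReducibleNPS p q r s ends
  /-- the pair swap -/
  | swap {p q r s : V} {ends : E → Sym2 V} (h : ReducibleNPS r s p q ends) :
      ReducibleNPS p q r s ends
  /-- the pendant reduction -/
  | pendant {p q r s : V} {ends : E → Sym2 V} {e₀ : E} {d v : V}
      (hd : ∀ e, d ∈ ends e → ¬ (ends e).IsDiag → e = e₀) (he₀ : ends e₀ = s(d, v))
      (hp : p ≠ d) (hq : q ≠ d) (hr : r ≠ d) (hs : s ≠ d)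
      (h : ReducibleNPS p q r s (Function.update ends e₀ s(d, d))) : ReducibleNPS p q r s ends
  /-- the series reduction -/
  | series {p q r s : V} {ends : E → Sym2 V} {e₁ e₂ : E} {d x y : V} (hne : e₁ ≠ e₂)
      (hd : ∀ e, d ∈ ends e → ¬ (ends e).IsDiag → e = e₁ ∨ e = e₂)
      (h₁ : ends e₁ = s(d, x)) (h₂ : ends e₂ = s(d, y)) (hx : x ≠ d) (hy : y ≠ d)
      (hp : p ≠ d) (hq : q ≠ d) (hr : r ≠ d) (hs : s ≠ d)
      (hG₁ : ReducibleNPS p q r s (Function.update (Function.update ends e₁ s(x, y)) e₂ s(d, d)))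
      (hG₀ : ReducibleNPS p q r s (Function.update (Function.update ends e₁ s(d, d)) e₂ s(d, d))) :
      ReducibleNPS p q r s ends
  /-- the parallel reduction -/
  | parallel {p q r s : V} {ends : E → Sym2 V} {e₁ e₂ : E} {x y : V} (hne : e₁ ≠ e₂)
      (h₁ : ends e₁ = s(x, y)) (h₂ : ends e₂ = s(x, y))
      (hp : p ≠ y) (hq : q ≠ y) (hr : r ≠ y) (hs : s ≠ y)
      (hG₁ : ReducibleNPS p q r s (Function.update ends e₂ s(x, x)))
      (hGc : ReducibleNPS p q r s (contract ends x y)) : ReducibleNPS p q r s ends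

/-- **`m9` in sign form on the reducible class with the no-pocket base**:
`Σ_{Sep} σ_pq · σ_rs ≤ 0` on every marked multigraph that series–parallel-reduces at non-marks
to a `DZero` graph, a cut-vertex graph, a no-pocket single-`d` graph or a no-pocket
multi-`d` graph. -/
theorem m9SignSum_nonpos_of_reducibleNPS {p q r s : V} {ends : E → Sym2 V}
    (h : ReducibleNPS p q r s ends) : m9SignSum ends p q r s ≤ 0 := by
  induction h with
  | ofReducibleNP h => exact m9SignSum_nonpos_of_reducibleNP h
  | noPocketSet hnp hind hadj hpD hqD hDr hDs =>
    exact NoPocketSet.m9SignSum_nonpos_of_multiD_noPocket hnp hind hadj hpD hqD hDr hDs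
  | swap _ ih => rw [m9SignSum_comm]; exact ih
  | pendant hd he₀ hp hq hr hs _ ih => rw [m9SignSum_pendant hd he₀ hp hq hr hs]; exact ih
  | series hne hd h₁ h₂ hx hy hp hq hr hs _ _ ih₁ ih₀ =>
    have hid := m9SignSum_series hne hd h₁ h₂ hx hy hp hq hr hs
    linarith
  | parallel hne h₁ h₂ hp hq hr hs _ _ ih₁ ihc =>
    exact m9SignSum_nonpos_of_parallel hne h₁ h₂ hp hq hr hs ih₁ ihc

end ReducibleNPS

end M9Reduce

end Summit.Ventures.PercRepro2
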